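import Mathlib
import Literature.Geometry.DiscreteGeometry.LayerShells
import Summits.NavierStokesRegularity.NavierStokesRegularity.Theorems.ThreadingFluxHorizonTowerHomogeneousCubic
import Summits.NavierStokesRegularity.NavierStokesRegularity.Theorems.ThreadingFluxHorizonTowerHarmonicCubic
import Summits.NavierStokesRegularity.NavierStokesRegularity.Theorems.ThreadingFluxHorizonTowerZonalForm
import HarnessLib
/-!
# Crux `PoloidalLiouville` (stmt-NavierStokesRegularity-1222, wall W1), crux idea «horizon-threading-tower» (ns-idea-15):
# ALL-DEGREE horizon zonality, kernel part F3 — real polynomial operators, polynomial calculus on ℝ³, and the SMOOTH ⇒ POLYNOMIAL bridge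

Support file (Theorems-side tooling; seat ns-wall-eng-5 g4, cell ns-wall-extremal, W1 adjunct; `--supports stmt-NavierStokesRegularity-1222
--as helper`).  Memo of record: pub/ns-wall-extremal/ARM-B/zonal-eng5/PROOF-HZSD-ALL-L.md (DATUM B-w5.8; paper proof critic-replicated by
ns-wall-crit-1 g2 2026-08-28T22:52:10Z); one-file kernel proof AllDev-HorizonZonalitySingleDegree.lean 53719c2c2d5f6cf4 of which this is a slice.

Content (memo §0 / kernel plan F3):
* the real-side operators on `MvPolynomial (Fin 3) R`: `lapP` (flat Laplacian), `dotP` (`∇a·∇b`), `detP a b = det(∇a, ∇b, x)`,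
  `DP p = det(∇p, ∇(∇p·∇p), x)` (the cubic form of the memo), `rotP p = x₀∂₁p − x₁∂₀p` (`= ⟪e₂ × x, ∇p⟫`), commuting with coefficient maps;
* polynomial FUNCTIONS on `ℝ³` (`evalE`): smoothness, `hasFDerivAt_evalE`, `gradient_evalE_apply` (`(∇p)ⱼ = ∂ⱼp`),
  `laplacian_evalE` (Mathlib's Laplacian of a polynomial function = `lapP`), `det_evalE` (the det-zonality integrand = `DP`),
  `rot_evalE`, `eq_zero_of_evalE_eq_zero`;
* ★ `exists_mvPolynomial_of_homogeneous`: a smooth function on ℝ³, homogeneous of degree `l` under all real dilations, IS a homogeneous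
  polynomial of degree `l` (general `l`; `l`-th Taylor term via `factorial_mul_eq_iteratedFDeriv_of_homogeneous` p669328 + multilinear expansion).

HONEST LABEL: a lemma toward / part of the kernel proof of the crux-idea obstruction `HorizonTower.HorizonZonalitySingleDegree` (all `l`);
`PoloidalLiouville` (1222), `UnthreadedRigidity` (27585), the NS-dynamics levers `OrderTwoHorizonLaw(Blowdown)` and NS regularity remain OPEN
and untouched; W1/W2 movement 0.  [folklore]
-/

-- the summit and its single problem share the name (D-0017 nested layout)
set_option linter.dupNamespace false

noncomputable section

open MvPolynomial Finsupp
open scoped RealInnerProductSpace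
open Literature.Analysis.FluidPDE (cross)
open Literature.Geometry.DiscreteGeometry (inner_fin3 norm_sq_fin3)

namespace Summit.NavierStokesRegularity.NavierStokesRegularity.Theorems.PoloidalLiouville.HorizonTower.Zonal

/-! ### Real polynomial operators: flat Laplacian, gradient pairing, triple product, the cubic form, the rotation generator -/

section RealOps



variable {R : Type*} [CommRing R]

/-- The (flat) Laplacian `∂₀² + ∂₁² + ∂₂²` of a polynomial in three variables. -/
def lapP (p : MvPolynomial (Fin 3) R) : MvPolynomial (Fin 3) R :=
  pderiv 0 (pderiv 0 p) + pderiv 1 (pderiv 1 p) + pderiv 2 (pderiv 2 p)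

/-- The gradient pairing `∇a·∇b` of polynomials in three variables. -/
def dotP (a b : MvPolynomial (Fin 3) R) : MvPolynomial (Fin 3) R :=
  pderiv 0 a * pderiv 0 b + pderiv 1 a * pderiv 1 b + pderiv 2 a * pderiv 2 b

/-- The triple product `det(∇a, ∇b, x) = ⟪∇a, ∇b × x⟫ = ⟪x, ∇a × ∇b⟫` of polynomials in three variables. -/
def detP (a b : MvPolynomial (Fin 3) R) : MvPolynomial (Fin 3) R :=
  X 0 * (pderiv 1 a * pderiv 2 b - pderiv 2 a * pderiv 1 b) + X 1 * (pderiv 2 a * pderiv 0 b - pderiv 0 a * pderiv 2 b)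
    + X 2 * (pderiv 0 a * pderiv 1 b - pderiv 1 a * pderiv 0 b)

/-- The cubic form `D(p) = det(∇p, ∇(∇p·∇p), x)` of the memo (polynomial version). -/
def DP (p : MvPolynomial (Fin 3) R) : MvPolynomial (Fin 3) R := detP p (dotP p p)

/-- The rotation generator about `e₂`: `L p = x₀ ∂₁p − x₁ ∂₀p = ⟪e₂ × x, ∇p⟫`. -/
def rotP (p : MvPolynomial (Fin 3) R) : MvPolynomial (Fin 3) R := X 0 * pderiv 1 p - X 1 * pderiv 0 p

variable {S : Type*} [CommRing S] (f : R →+* S)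

/-- `lapP` commutes with coefficient maps. [folklore] -/
theorem map_lapP (p : MvPolynomial (Fin 3) R) : map f (lapP p) = lapP (map f p) := by
  simp [lapP, pderiv_map]

/-- `dotP` commutes with coefficient maps. [folklore] -/
theorem map_dotP (a b : MvPolynomial (Fin 3) R) : map f (dotP a b) = dotP (map f a) (map f b) := by
  simp [dotP, pderiv_map]

/-- `detP` commutes with coefficient maps. [folklore] -/
theorem map_detP (a b : MvPolynomial (Fin 3) R) : map f (detP a b) = detP (map f a) (map f b) := by
  simp [detP, pderiv_map, map_X]

/-- `DP` commutes with coefficient maps. [folklore] -/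
theorem map_DP (p : MvPolynomial (Fin 3) R) : map f (DP p) = DP (map f p) := by
  rw [DP, map_detP, map_dotP, DP]

/-- `rotP` commutes with coefficient maps. [folklore] -/
theorem map_rotP (p : MvPolynomial (Fin 3) R) : map f (rotP p) = rotP (map f p) := by
  simp [rotP, pderiv_map, map_X]

end RealOps

/-! ### Polynomial functions on `ℝ³` -/

section PolyFun

/-- A real polynomial in three variables as a function on `ℝ³ = EuclideanSpace ℝ (Fin 3)`. -/
def evalE (p : MvPolynomial (Fin 3) ℝ) : E3 → ℝ := fun y => eval (fun i => y i) p

/-- Constants evaluate to constants. [folklore] -/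
@[simp] theorem evalE_C (a : ℝ) (y : E3) : evalE (C a) y = a := by simp [evalE]
/-- Variables evaluate to coordinates. [folklore] -/
@[simp] theorem evalE_X (i : Fin 3) (y : E3) : evalE (X i) y = y i := by simp [evalE]
/-- `1` evaluates to `1`. [folklore] -/
@[simp] theorem evalE_one (y : E3) : evalE 1 y = 1 := by simp [evalE]
/-- `0` evaluates to `0`. [folklore] -/
@[simp] theorem evalE_zero (y : E3) : evalE 0 y = 0 := by simp [evalE]
/-- Evaluation is additive. [folklore] -/
@[simp] theorem evalE_add (p q : MvPolynomial (Fin 3) ℝ) (y : E3) : evalE (p + q) y = evalE p y + evalE q y := by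
  simp [evalE]
/-- Evaluation respects subtraction. [folklore] -/
@[simp] theorem evalE_sub (p q : MvPolynomial (Fin 3) ℝ) (y : E3) : evalE (p - q) y = evalE p y - evalE q y := by
  simp [evalE]
/-- Evaluation is multiplicative. [folklore] -/
@[simp] theorem evalE_mul (p q : MvPolynomial (Fin 3) ℝ) (y : E3) : evalE (p * q) y = evalE p y * evalE q y := by
  simp [evalE]

/-- Constants as functions. [folklore] -/
theorem evalE_C_fun (a : ℝ) : evalE (C a) = fun _ => a := funext (evalE_C a)
/-- Sums as functions. [folklore] -/
theorem evalE_add_fun (p q : MvPolynomial (Fin 3) ℝ) : evalE (p + q) = fun y => evalE p y + evalE q y :=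
  funext (evalE_add p q)
/-- Multiplication by a variable as functions. [folklore] -/
theorem evalE_mul_X_fun (p : MvPolynomial (Fin 3) ℝ) (i : Fin 3) : evalE (p * X i) = fun y => evalE p y * y i := by
  funext y; rw [evalE_mul, evalE_X]

/-- Coordinate functions are smooth. -/
theorem contDiff_coord (i : Fin 3) : ContDiff ℝ (⊤ : ℕ∞) (fun y : E3 => y i) :=
  (EuclideanSpace.proj i : E3 →L[ℝ] ℝ).contDiff

/-- Polynomial functions are smooth. -/
theorem contDiff_evalE (p : MvPolynomial (Fin 3) ℝ) : ContDiff ℝ (⊤ : ℕ∞) (evalE p) := by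
  induction p using MvPolynomial.induction_on with
  | C a => rw [evalE_C_fun]; exact contDiff_const
  | add p q hp hq => rw [evalE_add_fun]; exact hp.add hq
  | mul_X p i hp => rw [evalE_mul_X_fun]; exact hp.mul (contDiff_coord i)

/-- The Fréchet derivative of a polynomial function: `D(p)(y) = Σᵢ (∂ᵢp)(y) · dxᵢ`. -/
def gradCLM (p : MvPolynomial (Fin 3) ℝ) (y : E3) : E3 →L[ℝ] ℝ :=
  ∑ i : Fin 3, evalE (pderiv i p) y • (EuclideanSpace.proj i : E3 →L[ℝ] ℝ)

/-- The derivative applied to a vector: `Σᵢ (∂ᵢp)(y) vᵢ`. [folklore] -/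
theorem gradCLM_apply (p : MvPolynomial (Fin 3) ℝ) (y v : E3) :
    gradCLM p y v = ∑ i : Fin 3, evalE (pderiv i p) y * v i := by
  simp [gradCLM]

/-- **Polynomial calculus**: `evalE p` has derivative `gradCLM p y` at every point. [folklore] -/
theorem hasFDerivAt_evalE (p : MvPolynomial (Fin 3) ℝ) (y : E3) : HasFDerivAt (evalE p) (gradCLM p y) y := by
  classical
  induction p using MvPolynomial.induction_on with
  | C a =>
    have h : gradCLM (C a : MvPolynomial (Fin 3) ℝ) y = 0 := by simp [gradCLM]
    rw [h, evalE_C_fun]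
    exact hasFDerivAt_const a y
  | add p q hp hq =>
    have h : gradCLM (p + q) y = gradCLM p y + gradCLM q y := by
      simp [gradCLM, Finset.sum_add_distrib, add_smul]
    rw [h, evalE_add_fun]
    exact hp.add hq
  | mul_X p i hp =>
    have hX : HasFDerivAt (fun y : E3 => y i) (EuclideanSpace.proj i : E3 →L[ℝ] ℝ) y :=
      (EuclideanSpace.proj i : E3 →L[ℝ] ℝ).hasFDerivAt
    rw [evalE_mul_X_fun]
    refine (hp.mul hX).congr_fderiv ?_
    ext v
    simp only [gradCLM_apply, pderiv_mul, evalE_add, evalE_mul, evalE_X, _root_.add_apply, _root_.smul_apply, smul_eq_mul]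
    have hterm : ∀ j : Fin 3, (evalE (pderiv j p) y * y i + evalE p y * evalE (pderiv j (X i)) y) * v j
        = y i * (evalE (pderiv j p) y * v j) + (if j = i then evalE p y * v i else 0) := by
      intro j
      by_cases hji : j = i
      · subst hji; rw [pderiv_X_self, if_pos rfl, evalE_one]; ring
      · rw [pderiv_X_of_ne (fun h => hji h.symm), if_neg hji, evalE_zero]; ring
    rw [Finset.sum_congr rfl (fun j _ => hterm j), Finset.sum_add_distrib, Finset.sum_ite_eq' Finset.univ i,
      if_pos (Finset.mem_univ i), ← Finset.mul_sum]
    simp [PiLp.proj_apply]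
    ring

/-- `fderiv` of a polynomial function applied to a vector. [folklore] -/
theorem fderiv_evalE_apply (p : MvPolynomial (Fin 3) ℝ) (y v : E3) :
    fderiv ℝ (evalE p) y v = ∑ i : Fin 3, evalE (pderiv i p) y * v i := by
  rw [(hasFDerivAt_evalE p y).fderiv, gradCLM_apply]

/-- Polynomial functions are differentiable. [folklore] -/
theorem differentiable_evalE (p : MvPolynomial (Fin 3) ℝ) : Differentiable ℝ (evalE p) :=
  fun y => (hasFDerivAt_evalE p y).differentiableAt

/-- Coordinates of the gradient of a polynomial function: `(∇p)(y)ⱼ = (∂ⱼ p)(y)`. [folklore] -/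
theorem gradient_evalE_apply (p : MvPolynomial (Fin 3) ℝ) (y : E3) (j : Fin 3) :
    gradient (evalE p) y j = evalE (pderiv j p) y := by
  have h := inner_gradient_eq_fderiv (evalE p) y (EuclideanSpace.single j 1)
  rw [fderiv_evalE_apply, inner_fin3, Fin.sum_univ_three] at h
  fin_cases j <;> simp at h ⊢ <;> linarith

/-- `‖∇p‖² = (∇p·∇p)` as polynomial functions. [folklore] -/
theorem norm_gradient_sq_evalE (p : MvPolynomial (Fin 3) ℝ) :
    (fun w : E3 => ‖gradient (evalE p) w‖ ^ 2) = evalE (dotP p p) := by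
  funext w
  rw [norm_sq_fin3, gradient_evalE_apply, gradient_evalE_apply, gradient_evalE_apply]
  simp [dotP, evalE]
  ring

/-- The det-condition integrand of a polynomial function is the polynomial `DP p`:
`⟪∇p(x), ∇‖∇p‖²(x) × x⟫ = (DP p)(x)`. [folklore] -/
theorem det_evalE (p : MvPolynomial (Fin 3) ℝ) (x : E3) :
    ⟪gradient (evalE p) x, cross (gradient (fun w : E3 => ‖gradient (evalE p) w‖ ^ 2) x) x⟫ = evalE (DP p) x := by
  rw [norm_gradient_sq_evalE, inner_fin3]
  obtain ⟨c0, c1, c2⟩ := cross_fin3 (gradient (evalE (dotP p p)) x) x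
  rw [c0, c1, c2]
  simp only [gradient_evalE_apply]
  simp [DP, detP, evalE]
  ring

/-- The rotation generator about `e₂` on a polynomial function: `⟪e₂ × y, ∇p(y)⟫ = (rotP p)(y)`. [folklore] -/
theorem rot_evalE (p : MvPolynomial (Fin 3) ℝ) (y : E3) :
    ⟪cross (EuclideanSpace.single 2 (1 : ℝ)) y, gradient (evalE p) y⟫ = evalE (rotP p) y := by
  rw [inner_fin3]
  obtain ⟨c0, c1, c2⟩ := cross_fin3 (EuclideanSpace.single 2 (1 : ℝ)) y
  rw [c0, c1, c2]
  simp only [gradient_evalE_apply]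
  simp [rotP, evalE]
  ring

/-- Derivative along a coordinate line: `d/dt p(x + t eₘ) = (∂ₘ p)(x + t eₘ)`. [folklore] -/
theorem hasDerivAt_evalE_line (p : MvPolynomial (Fin 3) ℝ) (x : E3) (m : Fin 3) (t : ℝ) :
    HasDerivAt (fun s : ℝ => evalE p (x + s • EuclideanSpace.single m (1 : ℝ)))
      (evalE (pderiv m p) (x + t • EuclideanSpace.single m (1 : ℝ))) t := by
  have hline : HasDerivAt (fun s : ℝ => x + s • EuclideanSpace.single m (1 : ℝ)) (EuclideanSpace.single m (1 : ℝ)) t := by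
    simpa using ((hasDerivAt_id t).smul_const (EuclideanSpace.single m (1 : ℝ))).const_add x
  have h := (hasFDerivAt_evalE p (x + t • EuclideanSpace.single m (1 : ℝ))).comp_hasDerivAt t hline
  refine h.congr_deriv ?_
  rw [gradCLM_apply, Fin.sum_univ_three]
  fin_cases m <;> simp

/-- **Laplacian of a polynomial function** = the polynomial Laplacian: `Δ(p)(y) = (lapP p)(y)`. [folklore] -/
theorem laplacian_evalE (p : MvPolynomial (Fin 3) ℝ) (y : E3) : Laplacian.laplacian (evalE p) y = evalE (lapP p) y := by
  rw [laplacian_eq_sum_iteratedDeriv_line ((contDiff_evalE p).of_le (by norm_cast)) y, Fin.sum_univ_three]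
  have key : ∀ m : Fin 3, iteratedDeriv 2 (fun t : ℝ => evalE p (y + t • EuclideanSpace.single m (1 : ℝ))) 0
      = evalE (pderiv m (pderiv m p)) y := by
    intro m
    rw [iteratedDeriv_succ, iteratedDeriv_one]
    have h1 : deriv (fun t : ℝ => evalE p (y + t • EuclideanSpace.single m (1 : ℝ)))
        = fun t => evalE (pderiv m p) (y + t • EuclideanSpace.single m (1 : ℝ)) := by
      funext t; exact (hasDerivAt_evalE_line p y m t).deriv
    rw [h1, (hasDerivAt_evalE_line (pderiv m p) y m 0).deriv]
    simp
  rw [key 0, key 1, key 2]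
  simp [lapP]

/-- A polynomial function vanishing identically is the zero polynomial. [folklore] -/
theorem eq_zero_of_evalE_eq_zero {p : MvPolynomial (Fin 3) ℝ} (h : ∀ y : E3, evalE p y = 0) : p = 0 := by
  apply MvPolynomial.funext
  intro x
  have := h (WithLp.toLp 2 x)
  simpa [evalE] using this

end PolyFun

/-! ### Smooth homogeneous functions are polynomial -/

section Bridge

/-- **A smooth function on `ℝ³`, homogeneous of degree `l` under all real dilations, is a homogeneous polynomial of degree `l`**
(its `l`-th Taylor term at the origin, expanded in coordinates). [folklore] -/
theorem exists_mvPolynomial_of_homogeneous {H : E3 → ℝ} {l : ℕ} (hH : ContDiff ℝ (⊤ : ℕ∞) H)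
    (hhom : ∀ (c : ℝ) (y : E3), H (c • y) = c ^ l * H y) :
    ∃ p : MvPolynomial (Fin 3) ℝ, p.IsHomogeneous l ∧ ∀ y : E3, H y = evalE p y := by
  classical
  set D := iteratedFDeriv ℝ l H 0 with hD
  set e : Fin 3 → E3 := fun i => EuclideanSpace.single i (1 : ℝ) with he
  -- the polynomial: `p = (1/l!) Σ_σ D(e_σ₁, …, e_σₗ) · X_σ₁ ⋯ X_σₗ`
  refine ⟨∑ σ : Fin l → Fin 3, C (D (fun k => e (σ k)) / l.factorial) * ∏ k : Fin l, X (σ k), ?_, ?_⟩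
  · refine IsHomogeneous.sum _ _ _ fun σ _ => ?_
    have hprod : (∏ k : Fin l, (X (σ k) : MvPolynomial (Fin 3) ℝ)).IsHomogeneous (∑ k : Fin l, 1) :=
      IsHomogeneous.prod _ _ _ fun k _ => isHomogeneous_X ℝ (σ k)
    simp only [Finset.sum_const, Finset.card_univ, Fintype.card_fin, smul_eq_mul, mul_one] at hprod
    simpa using (isHomogeneous_C (Fin 3) (D (fun k => e (σ k)) / l.factorial)).mul hprod
  · intro y
    have hfac : (l.factorial : ℝ) * H y = D (fun _ => y) :=
      factorial_mul_eq_iteratedFDeriv_of_homogeneous (hH.of_le (by norm_cast; exact le_top)) hhom y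
    -- expand `y` in the standard basis in every slot
    have hy : (fun _ : Fin l => y) = fun _ : Fin l => ∑ i : Fin 3, y i • e i := by
      funext k
      have : y = ∑ i : Fin 3, y i • e i := by
        ext j; simp [he, Fin.sum_univ_three]; fin_cases j <;> simp
      exact this
    have hexp : D (fun _ => y) = ∑ σ : Fin l → Fin 3, (∏ k : Fin l, y (σ k)) * D (fun k => e (σ k)) := by
      rw [hy, ContinuousMultilinearMap.map_sum D (fun (_ : Fin l) (i : Fin 3) => y i • e i)]
      refine Finset.sum_congr rfl fun σ _ => ?_
      rw [ContinuousMultilinearMap.map_smul_univ D (fun k => y (σ k)) (fun k => e (σ k)), smul_eq_mul]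
    have hl : (l.factorial : ℝ) ≠ 0 := by exact_mod_cast l.factorial_ne_zero
    have hHy : H y = D (fun _ => y) / l.factorial := by
      field_simp; linarith [hfac]
    rw [hHy, hexp, Finset.sum_div]
    simp only [evalE, map_sum, map_mul, eval_C, map_prod, eval_X]
    refine Finset.sum_congr rfl fun σ _ => ?_
    ring

end Bridge

end Summit.NavierStokesRegularity.NavierStokesRegularity.Theorems.PoloidalLiouville.HorizonTower.Zonal

end
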